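import Literature.Computability.Cryptography.ShorDiscreteLogBlock
import Literature.Computability.Cryptography.KitaevFamilyUniform
import Literature.Computability.QuantumComplexity.CleanBlockDesc
import Literature.Computability.QuantumComplexity.RevCleanPoly
import Literature.Computability.Cryptography.QuantumCircuitDescFP
import HarnessLib

/-!
# Kitaev's discrete-logarithm family is polynomial-time uniform
(`kitaevDLogBlockFamily_isUniform` and `Kitaev1995_dlogFamily` discharged)

Family `PQC` (trunk `CryptoQuantFine`); sequel of `ShorDiscreteLogBlock.lean` (the block `VD`,
its semantics, and `Kitaev1995_dlogFamily_of : kitaevDLogBlockFamily_isUniform →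
Kitaev1995_dlogFamily`). Here the remaining programming fact: **the description
`1^ℓ ↦ sigmaEncode ⟨ℓ, dlNumControls ℓ + mWD ℓ, kitaevCircuit (VD ℓ) (dlTypeOf ℓ)⟩` of Kitaev's
discrete-logarithm family is computable in polynomial time** (Shor 1997, §2, p. 7: "the design
of the gate array be produced by a polynomial-time (classical) computation"; Kitaev 1995, §4,
p. 15: "our procedure is uniform … constructed in time `poly(k+n)` by a classical Turing
machine"; `P`-uniformity, Arora–Barak 2009, Def. 6.12). By
`QCircuitFamily.isUniform_iff_descFn_mem_FP` (`QuantumCircuitDescFP.lean`) it suffices to write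
the description function as an `FP` string function, piece by piece:

* the header `⟨bin ℓ, ⟨1^{anc}, …⟩⟩` (`lenBinF`, `ancF`: the ancilla count
  `width (dataND ℓ) - ℓ` in unary through `RevClean.widthPoly`, `RevCleanPoly.lean`);
* the Hadamard layer on the `dlNumControls ℓ` control wires — a one-loop generator program
  `hadG` in the language of `GenPrograms.lean`/`RevTableauUniform.lean`, rendered by
  `GStmt.render_out_mem_FP`, with the stream identity `render_out_hadG`;
* the clean double modular-exponentiation block — `RevClean.flatMap_opBits_cleanOps_mem_FP`
  (`CleanBlockDesc.lean`, no suffix) with `RevDesc.flatMap_gateEnc_revCompile_toRevList`;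
* the phase layer `S³` on the sine-test wires — a two-loop generator `phaseG` over the
  `8 (ℓ+1)` (generator-trial, level) pairs and the `B` wires of each sine window, with the
  arithmetic form of the layout `dlTypeOf_eq` (`τ = (j / B) mod 2`) and `render_out_phaseG`;
* `descF`, `descF_eq : (kitaevDLogFamily mWD VD).descFn = descF`,
  **`kitaevDLogBlockFamily_isUniform_holds`** and **`Kitaev1995_dlogFamily_holds`**.

The order-finding twin is `KitaevFamilyUniform.lean` (`ModExpBlock.kitaevModExpFamily_isUniform_holds`,
whose `flatMap_range_mul` is reused); the layouts differ (`dlNumControls`, generator-trials,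
no suffix), so the generators and stream identities are this file's own.

## References

* P. W. Shor, *Polynomial-time algorithms for prime factorization and discrete logarithms on a
  quantum computer*, SIAM J. Comput. 26 (1997) 1484–1509, §2 p. 7 (uniform gate arrays), §6.
* A. Yu. Kitaev, *Quantum measurements and the Abelian Stabilizer Problem*, arXiv:quant-ph/9511026
  (1995), §3 Remark 8 (the sine tests), §4 p. 15 (uniformity).
* S. Arora, B. Barak, *Computational Complexity: A Modern Approach*, CUP 2009, §6.2 Def. 6.12,
  Remark 6.7, proof of Thm. 6.15 (descriptions printed with counters).
-/

noncomputable section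

namespace Literature.Computability.Cryptography

namespace Kitaev1995

namespace DLogUniform

open _root_.Computability Polynomial Complexity Complexity.Brick Complexity.Plumb ShorFP QuantumComplexity
  QuantumComplexity.RevSim QuantumComplexity.RevDesc QuantumComplexity.RevClean DLogBlock

/-! #### Sizes as counter expressions in the family index `u = ℓ` -/

/-- The family index `ℓ`. [folklore] -/
def uE : GE := .var .uu

/-- The block length `B = 12288 (ℓ + 1)`. [folklore] -/
def BDE : GE := .mul (.const 12288) (.add uE (.const 1))

/-- The number of controls `K = 4 · (2 · ((ℓ+1) · 2B))`. [folklore] -/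
def KDE : GE := .mul (.const 4) (.mul (.const 2) (.mul (.add uE (.const 1)) (.mul (.const 2) BDE)))

/-- The number of data wires `N = ℓ + K`. [folklore] -/
def NDE : GE := .add uE KDE

/-- The number of (generator-trial, level) pairs `8 (ℓ + 1)`. [folklore] -/
def PPE : GE := .mul (.const 8) (.add uE (.const 1))

/-- The wire of repetition `jj` of the sine window of pair `tt`: `ℓ + ((2 tt + 1) B + jj)`.
[folklore] -/
def sWireDE : GE := .add uE (.add (.mul (.add (.mul (.const 2) (.var .tt)) (.const 1)) BDE) (.var .jj))

section eval

variable {env : GV → ℕ} {ℓ : ℕ} (hu : env .uu = ℓ)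
include hu

/-- Value of `uE`. [folklore] -/
theorem eval_uE : uE.eval env = ℓ := by rw [uE, GExpr.eval, hu]

/-- Value of `BDE`. [folklore] -/
theorem eval_BDE : BDE.eval env = dlBlockSize ℓ := by
  simp only [BDE, GExpr.eval, eval_uE hu]; rfl

/-- Value of `KDE`. [folklore] -/
theorem eval_KDE : KDE.eval env = dlNumControls ℓ := by
  simp only [KDE, GExpr.eval, eval_uE hu, eval_BDE hu]; rfl

/-- Value of `NDE`. [folklore] -/
theorem eval_NDE : NDE.eval env = dataND ℓ := by
  simp only [NDE, GExpr.eval, eval_uE hu, eval_KDE hu]; rfl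

/-- Value of `PPE`. [folklore] -/
theorem eval_PPE : PPE.eval env = 8 * (ℓ + 1) := by
  simp only [PPE, GExpr.eval, eval_uE hu]

/-- Value of `sWireDE`. [folklore] -/
theorem eval_sWireDE : sWireDE.eval env = ℓ + ((2 * env .tt + 1) * dlBlockSize ℓ + env .jj) := by
  simp only [sWireDE, GExpr.eval, eval_uE hu, eval_BDE hu]

end eval

/-- The environment of the family index. [folklore] -/
theorem envU_uu (ℓ : ℕ) : envU ℓ GV.uu = ℓ := GenProg.initEnv_self _ _

/-- `NDE` mentions only the family index. [folklore] -/
theorem inUU_NDE : InUU NDE := by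
  intro x hx
  simpa [NDE, KDE, BDE, uE, GExpr.fv] using hx

/-! #### The Hadamard layer -/

/-- **Generator of the Hadamard layer**: an `H` on each control wire `ℓ + j`, `j < K`.
[cite: AroraBarak2009, §6.2 (descriptions printed with counters)] -/
def hadG : GS := .loop .jj KDE (agateG ⟨.H, [.add uE (.var .jj)]⟩)

/-- The `H` gates of the layer, abstractly. [folklore] -/
def hGates (ℓ : ℕ) : List (AGate ℕ) := (List.range (dlNumControls ℓ)).map fun j => ⟨.H, [ℓ + j]⟩

/-- The stream of `hadG`. [folklore] -/
theorem out_hadG (ℓ : ℕ) : hadG.out (envU ℓ) = (hGates ℓ).flatMap AGate.toks := by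
  rw [hadG, GStmt.out, eval_KDE (envU_uu ℓ), hGates, List.flatMap_map]
  refine List.flatMap_congr fun j _ => ?_
  have hu : Function.update (envU ℓ) GV.jj j GV.uu = ℓ := by
    rw [Function.update_of_ne (by decide)]; exact envU_uu ℓ
  rw [out_agateG]
  simp [AGate.map, GExpr.eval, eval_uE hu]

/-- `hadG` does not reuse loop variables, and they avoid the input variable. [folklore] -/
theorem hygiene_hadG : GV.uu ∉ hadG.loopVars ∧ hadG.noReuse = true := by
  constructor
  · decide
  · rfl

/-- **The bits of the Hadamard layer as an `FP` function of `1^ℓ`.** [cite: AroraBarak2009, §6.2 Def. 6.12] -/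
theorem hadBits_mem_FP : (fun z : List Bool => Tok.render 0 (hadG.out (envU z.length))) ∈ FP :=
  GStmt.render_out_mem_FP hadG .uu hygiene_hadG.1 hygiene_hadG.2

/-- The rendered stream of `hadG` is the description of the Hadamard layer. [folklore] -/
theorem render_out_hadG (ℓ m : ℕ) :
    Tok.render 0 (hadG.out (envU ℓ)) = (hadamardLayer ℓ (dlNumControls ℓ) m).flatMap gateEnc := by
  rw [out_hadG, ← List.append_nil ((hGates ℓ).flatMap AGate.toks), render_flatMap_toks, Tok.render_nil,
    List.append_nil, hadamardLayer, coinWires, List.map_map, List.flatMap_map, hGates, List.flatMap_map,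
    ← List.map_coe_finRange_eq_range, List.flatMap_map]
  refine List.flatMap_congr fun j _ => ?_
  simp [gateEnc_hOn, val_coinWire, AGate.bits, symCode, symArity]

/-! #### The phase layer -/

/-- The three `S` gates of a sine wire, abstractly. [folklore] -/
def sss (w : ℕ) : List (AGate ℕ) := [⟨.S, [w]⟩, ⟨.S, [w]⟩, ⟨.S, [w]⟩]

/-- **Generator of the phase layer**: for each (generator-trial, level) pair the cosine window is
skipped and every wire of the sine window carries `S³`. [cite: Kitaev1995, §3 Remark 8; AroraBarak2009, §6.2] -/
def phaseG : GS :=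
  .loop .tt PPE (.loop .jj BDE (seqs [agateG ⟨.S, [sWireDE]⟩, agateG ⟨.S, [sWireDE]⟩, agateG ⟨.S, [sWireDE]⟩]))

/-- The `S` gates of the layer in the order of the generator, abstractly. [folklore] -/
def sGates (ℓ : ℕ) : List (AGate ℕ) :=
  (List.range (8 * (ℓ + 1))).flatMap fun pp => (List.range (dlBlockSize ℓ)).flatMap fun i =>
    sss (ℓ + ((2 * pp + 1) * dlBlockSize ℓ + i))

/-- The stream of `phaseG`. [folklore] -/
theorem out_phaseG (ℓ : ℕ) : phaseG.out (envU ℓ) = (sGates ℓ).flatMap AGate.toks := by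
  rw [phaseG, GStmt.out, eval_PPE (envU_uu ℓ), sGates, List.flatMap_assoc]
  refine List.flatMap_congr fun pp _ => ?_
  have hu : Function.update (envU ℓ) GV.tt pp GV.uu = ℓ := by
    rw [Function.update_of_ne (by decide)]; exact envU_uu ℓ
  rw [GStmt.out, eval_BDE hu, List.flatMap_assoc]
  refine List.flatMap_congr fun i _ => ?_
  have hu' : Function.update (Function.update (envU ℓ) GV.tt pp) GV.jj i GV.uu = ℓ := by
    rw [Function.update_of_ne (by decide)]; exact hu
  have hw : sWireDE.eval (Function.update (Function.update (envU ℓ) GV.tt pp) GV.jj i) =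
      ℓ + ((2 * pp + 1) * dlBlockSize ℓ + i) := by
    rw [eval_sWireDE hu', Function.update_self, Function.update_of_ne (by decide), Function.update_self]
  simp [sss, AGate.map, hw]

/-- `phaseG` does not reuse loop variables, and they avoid the input variable. [folklore] -/
theorem hygiene_phaseG : GV.uu ∉ phaseG.loopVars ∧ phaseG.noReuse = true := by
  constructor
  · decide
  · rfl

/-- **The bits of the phase layer as an `FP` function of `1^ℓ`.** [cite: AroraBarak2009, §6.2 Def. 6.12] -/
theorem phaseBits_mem_FP : (fun z : List Bool => Tok.render 0 (phaseG.out (envU z.length))) ∈ FP :=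
  GStmt.render_out_mem_FP phaseG .uu hygiene_phaseG.1 hygiene_phaseG.2

/-- The type of a control as arithmetic of its index: a sine test iff `(j / B) mod 2 = 1`.
[folklore] -/
theorem dlTypeOf_eq (ℓ : ℕ) (j : Fin (dlNumControls ℓ)) :
    dlTypeOf ℓ j = decide ((j : ℕ) / dlBlockSize ℓ % 2 = 1) := by
  obtain ⟨⟨t, η, l, τ, i⟩, rfl⟩ := (dlLayout ℓ).symm.surjective j
  rw [dlTypeOf, Equiv.apply_symm_apply, val_dlLayout_symm, dlOff]
  have hB : 0 < dlBlockSize ℓ := dlBlockSize_pos ℓ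
  have hdiv : ((((2 * ↑t + η.toNat) * dlNumLevels ℓ + ↑l) * 2 + τ.toNat) * dlBlockSize ℓ + ↑i) / dlBlockSize ℓ =
      ((2 * ↑t + η.toNat) * dlNumLevels ℓ + ↑l) * 2 + τ.toNat := by
    rw [Nat.add_comm, Nat.add_mul_div_right _ _ hB, Nat.div_eq_of_lt i.isLt, Nat.zero_add]
  rw [hdiv]
  cases τ <;> simp

/-- The phase layer, control by control, as arithmetic of the index. [folklore] -/
theorem flatMap_gateEnc_phaseLayer (ℓ m : ℕ) :
    (phaseLayer ℓ (dlNumControls ℓ) m (dlTypeOf ℓ)).flatMap gateEnc =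
      (List.range (dlNumControls ℓ)).flatMap fun j =>
        if j / dlBlockSize ℓ % 2 = 1 then (sss (ℓ + j)).flatMap AGate.bits else [] := by
  rw [phaseLayer, phaseLayerL, List.flatMap_assoc, ← List.map_coe_finRange_eq_range, List.flatMap_map]
  refine List.flatMap_congr fun j _ => ?_
  rw [dlTypeOf_eq]
  by_cases h : (j : ℕ) / dlBlockSize ℓ % 2 = 1
  · rw [decide_eq_true h, if_pos rfl, if_pos h]
    simp [sss, gateEnc_sOn, val_coinWire, AGate.bits, symCode, symArity]
  · rw [decide_eq_false h, if_neg h]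
    simp

/-- **The rendered stream of `phaseG` is the description of the phase layer** of the
discrete-logarithm layout. [cite: Kitaev1995, §3 Remark 8] -/
theorem render_out_phaseG (ℓ m : ℕ) :
    Tok.render 0 (phaseG.out (envU ℓ)) = (phaseLayer ℓ (dlNumControls ℓ) m (dlTypeOf ℓ)).flatMap gateEnc := by
  rw [out_phaseG, ← List.append_nil ((sGates ℓ).flatMap AGate.toks), render_flatMap_toks, Tok.render_nil,
    List.append_nil, flatMap_gateEnc_phaseLayer, sGates, List.flatMap_assoc]
  have hB : 0 < dlBlockSize ℓ := dlBlockSize_pos ℓ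
  have hK : dlNumControls ℓ = 8 * (ℓ + 1) * (dlBlockSize ℓ + dlBlockSize ℓ) := by
    unfold dlNumControls numTrials dlNumLevels; ring
  have hR := ModExpBlock.flatMap_range_mul (8 * (ℓ + 1)) (dlBlockSize ℓ + dlBlockSize ℓ)
    (fun j => if j / dlBlockSize ℓ % 2 = 1 then (sss (ℓ + j)).flatMap AGate.bits else [])
  rw [hK, hR]
  refine List.flatMap_congr fun pp _ => ?_
  rw [List.flatMap_assoc, flatMap_range_add]
  -- the cosine window contributes nothing
  have h0 : ((List.range (dlBlockSize ℓ)).flatMap fun r =>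
      if (pp * (dlBlockSize ℓ + dlBlockSize ℓ) + r) / dlBlockSize ℓ % 2 = 1 then
        (sss (ℓ + (pp * (dlBlockSize ℓ + dlBlockSize ℓ) + r))).flatMap AGate.bits else []) = [] := by
    rw [List.flatMap_eq_nil_iff]
    intro r hr
    rw [List.mem_range] at hr
    rw [if_neg]
    rw [show pp * (dlBlockSize ℓ + dlBlockSize ℓ) + r = r + 2 * pp * dlBlockSize ℓ by ring,
      Nat.add_mul_div_right _ _ hB, Nat.div_eq_of_lt hr]
    omega
  rw [h0, List.nil_append]
  refine List.flatMap_congr fun i hi => ?_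
  rw [List.mem_range] at hi
  rw [if_pos]
  · have e : pp * (dlBlockSize ℓ + dlBlockSize ℓ) + (dlBlockSize ℓ + i) = (2 * pp + 1) * dlBlockSize ℓ + i := by ring
    rw [e]
  · rw [show pp * (dlBlockSize ℓ + dlBlockSize ℓ) + (dlBlockSize ℓ + i) = i + (2 * pp + 1) * dlBlockSize ℓ by ring,
      Nat.add_mul_div_right _ _ hB, Nat.div_eq_of_lt hi]
    omega

/-! #### The clean block -/

/-- **The bits of the clean block as an `FP` function of `1^ℓ`** (`CleanBlockDesc`, no suffix).
[cite: AroraBarak2009, §6.2 Def. 6.12 and Remark 6.7] -/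
theorem blockBits_mem_FP : (fun z : List Bool => (opsND z.length).flatMap opBits) ∈ FP := by
  have h := flatMap_opBits_cleanOps_mem_FP (e := eD) (M := MD) NDE NDE [] inUU_NDE (by simp) (fun _ => []) (fun u => rfl)
    (fun u => by rw [List.length_nil, Nat.add_zero])
  refine (congrArg (· ∈ FP) (funext fun z => ?_)).mp h
  rw [opsND, eval_NDE (envU_uu z.length)]

/-- The description of the compiled block is the concatenation of the `opBits`. [folklore] -/
theorem flatMap_gateEnc_VD (ℓ : ℕ) : (VD ℓ).gates.flatMap gateEnc = (opsND ℓ).flatMap opBits :=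
  flatMap_gateEnc_revCompile_toRevList (layoutN_pos ℓ) (opsND ℓ) (opsN_lt ℓ) (opsFinB_wf ℓ)

/-! #### The description function -/

/-- The ancilla count `dlNumControls ℓ + mWD ℓ = width (dataND ℓ) - ℓ`, in unary, from `z`
(`|z| = ℓ`). [folklore] -/
def ancF : List Bool → List Bool := dropFn ∘ fanoutFn idF (polyFn ((widthPoly eD MD).comp lenPoly))

/-- `ancF ∈ FP`. [folklore] -/
theorem ancF_mem_FP : ancF ∈ FP := comp_mem_FP dropFn_mem_FP (fanoutFn_mem_FP idF_mem_FP (polyFn_mem_FP _))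

/-- Value of `ancF`. [folklore] -/
theorem ancF_apply (z : List Bool) : ancF z = unaryEncodeNat (dlNumControls z.length + mWD z.length) := by
  rw [ancF, Function.comp_apply, fanoutFn_apply, dropFn_boolPair, idF, polyFn_apply, Polynomial.eval_comp, lenPoly_eval,
    eval_widthPoly, Complexity.unaryEncodeNat_eq_replicate, List.drop_replicate]
  congr 1
  have := dataN_le_totN z.length
  unfold mWD totND dataND at *
  omega

/-- The gate bits: Hadamard layer, block, phase layer, Hadamard layer. [folklore] -/
def gatesF (z : List Bool) : List Bool :=
  Tok.render 0 (hadG.out (envU z.length)) ++ ((opsND z.length).flatMap opBits ++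
    (Tok.render 0 (phaseG.out (envU z.length)) ++ Tok.render 0 (hadG.out (envU z.length))))

/-- `gatesF ∈ FP`. [folklore] -/
theorem gatesF_mem_FP : gatesF ∈ FP :=
  Complexity.append_mem_FP hadBits_mem_FP (Complexity.append_mem_FP blockBits_mem_FP
    (Complexity.append_mem_FP phaseBits_mem_FP hadBits_mem_FP))

/-- **The description function of the family as a brick.** [folklore] -/
def descF : List Bool → List Bool := fanoutFn lenBinF (fanoutFn ancF gatesF)

/-- `descF ∈ FP`. [folklore] -/
theorem descF_mem_FP : descF ∈ FP := fanoutFn_mem_FP lenBinF_mem_FP (fanoutFn_mem_FP ancF_mem_FP gatesF_mem_FP)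

/-- **`descF` is the description function of `kitaevDLogFamily mWD VD`.** [cite: AroraBarak2009, §6.2] -/
theorem descF_eq : (kitaevDLogFamily mWD VD).descFn = descF := by
  funext z
  rw [QCircuitFamily.descFn_eq, descF, fanoutFn_apply, fanoutFn_apply, lenBinF_apply, ancF_apply]
  congr 2
  show QCircuit.encode (kitaevCircuit (VD z.length) (dlTypeOf z.length)) = gatesF z
  rw [kitaevCircuit, encode_eq_flatMap, List.flatMap_append, List.flatMap_append, List.flatMap_append, gatesF,
    render_out_hadG z.length (mWD z.length), render_out_phaseG z.length (mWD z.length), flatMap_gateEnc_VD]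
  simp only [List.append_assoc]

/-- **Discharge of `kitaevDLogBlockFamily_isUniform`**: the description of Kitaev's
discrete-logarithm family — header, the Hadamard layer (`hadG`), the clean double
modular-exponentiation block (`CleanBlockDesc`), the phase layer (`phaseG`), the Hadamard layer —
is printed from `1^ℓ` in polynomial time (Shor 1997, §2 p. 7; Kitaev 1995, §4 p. 15).
[cite: Shor1997, §2 p.7 (uniformity of the gate array); Kitaev1995, §4 p.15; AroraBarak2009, §6.2 Def. 6.12] -/
theorem kitaevDLogBlockFamily_isUniform_holds : kitaevDLogBlockFamily_isUniform := by
  rw [kitaevDLogBlockFamily_isUniform, QCircuitFamily.isUniform_iff_descFn_mem_FP, descF_eq]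
  exact descF_mem_FP

/-- **Discharge of `Kitaev1995_dlogFamily`** (`ShorDiscreteLogQuantum.lean`): Kitaev's
discrete-logarithm family around the clean double modular-exponentiation block exists, is
polynomial-time uniform, and its block computes the four products `g^{A_t} y^{B_t} mod p` without
garbage. [cite: Shor1997, §6 p.16 with §3 p.8 and §2 p.7; Kitaev1995, §2.2 Lemma 1 and §4 p.15] -/
theorem _root_.Literature.Computability.Cryptography.Kitaev1995_dlogFamily_holds : Kitaev1995_dlogFamily :=
  Kitaev1995_dlogFamily_of kitaevDLogBlockFamily_isUniform_holds

end DLogUniform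

end Kitaev1995

end Literature.Computability.Cryptography

end
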